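import Literature.Computability.Cryptography.CoprimePairing
import Mathlib.Algebra.Order.BigOperators.Group.Finset
import Mathlib.Algebra.Order.AbsoluteValue.Basic
import HarnessLib

/-!
# The class-group stage: the law of a paired sample is near-uniform (proper subgroups are hit with probability `≲ 1/2`)

Topic `Computability/Cryptography`; finite probability behind the post-processing of the class-group stage of the crux
`LinnikCubicClassGroups.PureCubicClassGroupFBQP` (line `arakelov-giant-step-cycle`; consumer: the proof of
`CubicClassSampling.ClaimPost`). Theorem file; no definitions, no named facts.

Two independent unit outcomes `c, c'` with law `w` are ACCURATE with labels `(kk, g)`, `(kk', g')` (`g, g'` in a finite abelian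
group `G`, the dual group of the hidden lattice) or inaccurate; a reference weight `w₁` within `ε₃` of `w` in `ℓ¹` is, for each
residue `kk`, pointwise `(1+ε₂)`-near-uniform in `g` (`CubicClassSampling.UnitSamplingLaw` (b)). The post-processor combines the
pair with coprime coefficients `c₁ g + c₂ g'` depending on `(kk, kk')` only. Then for every `H ⊆ G` with `2|H| ≤ |G|` (a proper
subgroup) the probability that both outcomes are accurate AND the combination lands in `H` is at most
`(1+ε₂)²/2 · (1+ε₃)²` (`≤ (1+ε₂)²/2 + 3ε₃` in the regime of interest):

* `sum_pair_filter_le` — the statement on aggregated weights `W kk g` (per residue and group element): pointwise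
  `W ≤ (1+ε₂)/|G| · M₁(kk) + (W − W₁)⁺`, expand, count the fibres of the coprime combination exactly
  (`CoprimePairing.card_filter_comb_eq`), and use `M₁ + 2 ∑ (W − W₁)⁺ ≤ ∑ W + ∑ |W − W₁| ≤ 1 + ε₃`;
* `sum_pair_event_le` — the same on outcomes `c ∈ S` with labels `acc`, `klab`, `glab` (fibrewise aggregation);
* `half_sq_mul_sq_le` — `(1+ε₂)²/2 (1+ε₃)² ≤ (1+ε₂)²/2 + 3 ε₃` when `(1+ε₂)² ≤ 2`, `ε₃ ≤ 1`.
[Hallgren 2005, §4; Kitaev 1995, §4]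

## References

* S. Hallgren, STOC 2005, §4. [Hallgren2005]
* A. Yu. Kitaev, arXiv:quant-ph/9511026 (1995), §4. [Kitaev1995]
-/

noncomputable section

namespace Literature.Computability.Cryptography

namespace CubicClassPost

open Finset

variable {G : Type*} [AddCommGroup G] [Fintype G] [DecidableEq G]

/-! ### Aggregated weights -/

/-- **Near-uniform pairs rarely land in a small set.** For weights `W, W₁ ≥ 0` on `ℤ × G` with `W₁(kk, ·)` pointwise
`≤ (1+ε₂)/|G| · ∑_g W₁(kk, g)`, total `W`-mass `≤ 1` over `kk ∈ K`, `∑ |W − W₁| ≤ ε₃`, coprime coefficients `cf kk kk'`, and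
`H ⊆ G` with `2|H| ≤ |G|`:
`∑_{kk, kk' ∈ K} ∑_{(g,g') : c₁ g + c₂ g' ∈ H} W(kk,g) W(kk',g') ≤ (1+ε₂)²/2 · (1+ε₃)²`. [cite: Hallgren2005, §4] -/
theorem sum_pair_filter_le (K : Finset ℤ) (W W₁ : ℤ → G → ℝ) (cf : ℤ → ℤ → ℤ × ℤ) {ε₂ ε₃ : ℝ} (H : Finset G)
    (hW : ∀ k g, 0 ≤ W k g) (hW₁ : ∀ k g, 0 ≤ W₁ k g)
    (hunif : ∀ k g, W₁ k g ≤ (1 + ε₂) / Fintype.card G * ∑ g', W₁ k g')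
    (hmass : ∑ k ∈ K, ∑ g, W k g ≤ 1) (hdiff : ∑ k ∈ K, ∑ g, |W k g - W₁ k g| ≤ ε₃)
    (hcf : ∀ k k', Int.gcd (cf k k').1 (cf k k').2 = 1) (hH : 2 * H.card ≤ Fintype.card G) (hε₂ : 0 ≤ ε₂) :
    ∑ k ∈ K, ∑ k' ∈ K, ∑ p ∈ (univ : Finset (G × G)).filter (fun p => (cf k k').1 • p.1 + (cf k k').2 • p.2 ∈ H),
        W k p.1 * W k' p.2 ≤ (1 + ε₂) ^ 2 / 2 * (1 + ε₃) ^ 2 := by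
  set h : ℕ := Fintype.card G with hh
  have hpos : (0 : ℝ) < h := by exact_mod_cast (Fintype.card_pos : 0 < Fintype.card G)
  set κ : ℝ := 1 + ε₂ with hκ
  have hκ1 : 1 ≤ κ := by rw [hκ]; linarith
  -- the normalisers, the uniform bound and the positive parts of the deviations
  set M₁ : ℤ → ℝ := fun k => ∑ g, W₁ k g with hM₁
  set u : ℤ → ℝ := fun k => κ / h * M₁ k with hu
  set D : ℤ → G → ℝ := fun k g => max (W k g - W₁ k g) 0 with hD
  set e : ℤ → ℝ := fun k => ∑ g, D k g with he
  have hM₁0 : ∀ k, 0 ≤ M₁ k := fun k => sum_nonneg fun g _ => hW₁ k g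
  have hu0 : ∀ k, 0 ≤ u k := fun k => mul_nonneg (div_nonneg (by linarith) hpos.le) (hM₁0 k)
  have hD0 : ∀ k g, 0 ≤ D k g := fun k g => le_max_right _ _
  have he0 : ∀ k, 0 ≤ e k := fun k => sum_nonneg fun g _ => hD0 k g
  -- pointwise: `W ≤ u + D`
  have hWle : ∀ k g, W k g ≤ u k + D k g := by
    intro k g
    have h1 : W₁ k g ≤ u k := hunif k g
    have h2 : W k g - W₁ k g ≤ D k g := le_max_left _ _
    linarith
  -- the inner sum for fixed residues
  have hinner : ∀ k k', ∑ p ∈ (univ : Finset (G × G)).filter (fun p => (cf k k').1 • p.1 + (cf k k').2 • p.2 ∈ H),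
      W k p.1 * W k' p.2 ≤ κ ^ 2 / 2 * (M₁ k * M₁ k') + κ * (M₁ k * e k') + κ * (M₁ k' * e k) + e k * e k' := by
    intro k k'
    set F := (univ : Finset (G × G)).filter (fun p => (cf k k').1 • p.1 + (cf k k').2 • p.2 ∈ H) with hF
    -- `|F| = |H| |G|`
    have hcardF : (F.card : ℝ) = H.card * h := by
      have hsplit : F = H.biUnion (fun y => (univ : Finset (G × G)).filter
          (fun p => (cf k k').1 • p.1 + (cf k k').2 • p.2 = y)) := by
        ext p; simp [hF, mem_biUnion, mem_filter]
      rw [hsplit, card_biUnion]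
      · simp_rw [CoprimePairing.card_filter_comb_eq (hcf k k')]
        rw [sum_const, smul_eq_mul]; push_cast; rw [hh]
      · intro y _ y' _ hne
        simp only [Function.onFun]
        rw [disjoint_filter]
        intro p _ hp hp'
        exact hne (hp.symm.trans hp')
    calc ∑ p ∈ F, W k p.1 * W k' p.2 ≤ ∑ p ∈ F, (u k + D k p.1) * (u k' + D k' p.2) :=
          sum_le_sum fun p _ => mul_le_mul (hWle _ _) (hWle _ _) (hW _ _) (add_nonneg (hu0 _) (hD0 _ _))
      _ = ∑ p ∈ F, u k * u k' + ∑ p ∈ F, (u k * D k' p.2 + D k p.1 * u k' + D k p.1 * D k' p.2) := by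
          rw [← sum_add_distrib]; refine sum_congr rfl fun p _ => by ring
      _ ≤ ∑ p ∈ F, u k * u k' + ∑ p ∈ (univ : Finset (G × G)), (u k * D k' p.2 + D k p.1 * u k' + D k p.1 * D k' p.2) :=
          add_le_add le_rfl (sum_le_sum_of_subset_of_nonneg (subset_univ F) fun p _ _ =>
            add_nonneg (add_nonneg (mul_nonneg (hu0 k) (hD0 k' p.2)) (mul_nonneg (hD0 k p.1) (hu0 k')))
              (mul_nonneg (hD0 k p.1) (hD0 k' p.2)))
      _ = u k * u k' * (H.card * h) + (u k * (h * e k') + e k * u k' * h + e k * e k') := by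
          rw [sum_const, nsmul_eq_mul, hcardF]
          congr 1
          · ring
          · rw [Fintype.sum_prod_type]
            simp only [sum_add_distrib]
            rw [he]
            simp only [sum_const, card_univ, nsmul_eq_mul, ← hh, ← mul_sum, ← sum_mul]
            rw [Fintype.sum_mul_sum]
            ring
      _ ≤ κ ^ 2 / 2 * (M₁ k * M₁ k') + κ * (M₁ k * e k') + κ * (M₁ k' * e k) + e k * e k' := by
          have hHh : (H.card : ℝ) * h ≤ h * h / 2 := by
            have : (2 * H.card : ℝ) ≤ h := by exact_mod_cast hH
            nlinarith
          have h1 : u k * u k' * (H.card * h) ≤ κ ^ 2 / 2 * (M₁ k * M₁ k') := by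
            calc u k * u k' * (H.card * h) ≤ u k * u k' * (h * h / 2) :=
                  mul_le_mul_of_nonneg_left hHh (mul_nonneg (hu0 _) (hu0 _))
              _ = κ ^ 2 / 2 * (M₁ k * M₁ k') := by rw [hu]; field_simp
          have h2 : u k * (h * e k') = κ * (M₁ k * e k') := by rw [hu]; field_simp
          have h3 : e k * u k' * h = κ * (M₁ k' * e k) := by rw [hu]; field_simp
          linarith
  -- sum over the residues
  set A : ℝ := ∑ k ∈ K, M₁ k with hA
  set E : ℝ := ∑ k ∈ K, e k with hE
  have hA0 : 0 ≤ A := sum_nonneg fun k _ => hM₁0 k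
  have hE0 : 0 ≤ E := sum_nonneg fun k _ => he0 k
  have hsum : ∑ k ∈ K, ∑ k' ∈ K, (κ ^ 2 / 2 * (M₁ k * M₁ k') + κ * (M₁ k * e k') + κ * (M₁ k' * e k) + e k * e k') =
      κ ^ 2 / 2 * (A * A) + 2 * κ * (A * E) + E * E := by
    simp only [sum_add_distrib, ← mul_sum, ← sum_mul]
    ring
  -- `A + 2E ≤ 1 + ε₃`: `(W₁ - W) + 2 (W - W₁)⁺ = |W - W₁|`
  have hAE : A + 2 * E ≤ 1 + ε₃ := by
    have hpt : ∀ k g, W₁ k g + 2 * D k g = W k g + |W k g - W₁ k g| := by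
      intro k g
      show W₁ k g + 2 * max (W k g - W₁ k g) 0 = W k g + |W k g - W₁ k g|
      rcases le_total (W k g) (W₁ k g) with hle | hle
      · rw [max_eq_right (by linarith), abs_of_nonpos (by linarith)]; ring
      · rw [max_eq_left (by linarith), abs_of_nonneg (by linarith)]; ring
    have : A + 2 * E = ∑ k ∈ K, ∑ g, W k g + ∑ k ∈ K, ∑ g, |W k g - W₁ k g| := by
      rw [hA, hE, hM₁, he, mul_sum, ← sum_add_distrib, ← sum_add_distrib]
      refine sum_congr rfl fun k _ => ?_
      rw [mul_sum, ← sum_add_distrib, ← sum_add_distrib]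
      exact sum_congr rfl fun g _ => hpt k g
    rw [this]
    linarith
  calc ∑ k ∈ K, ∑ k' ∈ K, ∑ p ∈ (univ : Finset (G × G)).filter
          (fun p => (cf k k').1 • p.1 + (cf k k').2 • p.2 ∈ H), W k p.1 * W k' p.2
      ≤ ∑ k ∈ K, ∑ k' ∈ K, (κ ^ 2 / 2 * (M₁ k * M₁ k') + κ * (M₁ k * e k') + κ * (M₁ k' * e k) + e k * e k') :=
        sum_le_sum fun k _ => sum_le_sum fun k' _ => hinner k k'
    _ = κ ^ 2 / 2 * (A * A) + 2 * κ * (A * E) + E * E := hsum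
    _ ≤ κ ^ 2 / 2 * ((A + 2 * E) * (A + 2 * E)) := by
        have hAE0 := mul_nonneg hA0 hE0
        have hEE0 := mul_nonneg hE0 hE0
        have hκκ : 0 ≤ κ * (κ - 1) := mul_nonneg (by linarith) (by linarith)
        have t1 : 2 * κ * (A * E) ≤ 2 * κ ^ 2 * (A * E) := by
          have := mul_nonneg hκκ hAE0
          nlinarith
        have hκ2 : 1 ≤ κ ^ 2 := by nlinarith
        have t2 : E * E ≤ 2 * κ ^ 2 * (E * E) := by
          have := mul_nonneg (by linarith : (0 : ℝ) ≤ 2 * κ ^ 2 - 1) hEE0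
          nlinarith
        have expand : κ ^ 2 / 2 * ((A + 2 * E) * (A + 2 * E)) =
            κ ^ 2 / 2 * (A * A) + 2 * κ ^ 2 * (A * E) + 2 * κ ^ 2 * (E * E) := by ring
        linarith
    _ ≤ κ ^ 2 / 2 * ((1 + ε₃) * (1 + ε₃)) := by
        have h0 : 0 ≤ A + 2 * E := by linarith
        exact mul_le_mul_of_nonneg_left (mul_le_mul hAE hAE h0 (h0.trans hAE)) (by positivity)
    _ = κ ^ 2 / 2 * (1 + ε₃) ^ 2 := by ring

/-! ### The statement on labelled outcomes -/

/-- **Near-uniform pairs rarely land in a small set** (outcome form). Outcomes `c ∈ S` carry a law `w ≥ 0` of mass `≤ 1` and a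
reference weight `w₁ ≥ 0` with `∑_S |w − w₁| ≤ ε₃`; accurate outcomes (`acc`) carry a residue `klab c` and a group element
`glab c`, and for every `(kk, g)` the `w₁`-mass of `{acc, klab = kk, glab = g}` is at most `(1+ε₂)/|G|` times the `w₁`-mass
of `{acc, klab = kk}`. Then for coprime coefficients `cf` and `H ⊆ G` with `2|H| ≤ |G|`, the `w ⊗ w`-mass of the pairs
`(c, c')` that are both accurate with `cf₁ glab c + cf₂ glab c' ∈ H` is `≤ (1+ε₂)²/2 · (1+ε₃)²`. [cite: Hallgren2005, §4] -/
theorem sum_pair_event_le {α : Type*} (S : Finset α) (acc : α → Prop) [DecidablePred acc] (klab : α → ℤ)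
    (glab : α → G) (w w₁ : α → ℝ) (cf : ℤ → ℤ → ℤ × ℤ) {ε₂ ε₃ : ℝ} (H : Finset G)
    (hw : ∀ c, 0 ≤ w c) (hw₁ : ∀ c, 0 ≤ w₁ c) (hmass : ∑ c ∈ S, w c ≤ 1) (hdiff : ∑ c ∈ S, |w c - w₁ c| ≤ ε₃)
    (hunif : ∀ (kk : ℤ) (g : G), ∑ c ∈ S.filter (fun c => acc c ∧ klab c = kk ∧ glab c = g), w₁ c ≤
      (1 + ε₂) / Fintype.card G * ∑ c ∈ S.filter (fun c => acc c ∧ klab c = kk), w₁ c)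
    (hcf : ∀ k k', Int.gcd (cf k k').1 (cf k k').2 = 1) (hH : 2 * H.card ≤ Fintype.card G) (hε₂ : 0 ≤ ε₂) :
    ∑ c ∈ S, ∑ c' ∈ S, (if acc c ∧ acc c' ∧ (cf (klab c) (klab c')).1 • glab c + (cf (klab c) (klab c')).2 • glab c' ∈ H
      then w c * w c' else 0) ≤ (1 + ε₂) ^ 2 / 2 * (1 + ε₃) ^ 2 := by
  classical
  -- aggregated weights
  set Sa := S.filter acc with hSa
  set K : Finset ℤ := Sa.image klab with hK
  set fib : ℤ → G → Finset α := fun k g => S.filter (fun c => acc c ∧ klab c = k ∧ glab c = g) with hfib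
  set W : ℤ → G → ℝ := fun k g => ∑ c ∈ fib k g, w c with hWd
  set W₁ : ℤ → G → ℝ := fun k g => ∑ c ∈ fib k g, w₁ c with hW₁d
  -- fibrewise aggregation over `Sa`
  have hmaps : ∀ c ∈ Sa, (klab c, glab c) ∈ K ×ˢ (univ : Finset G) := fun c hc =>
    mem_product.2 ⟨mem_image_of_mem _ hc, mem_univ _⟩
  have hfib_eq : ∀ k g, fib k g = Sa.filter (fun c => (klab c, glab c) = (k, g)) := by
    intro k g
    ext c
    simp only [hfib, hSa, mem_filter, Prod.mk.injEq, and_assoc]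
  have hagg : ∀ f : α → ℝ, ∑ c ∈ Sa, f c = ∑ k ∈ K, ∑ g, ∑ c ∈ fib k g, f c := by
    intro f
    rw [← sum_fiberwise_of_maps_to hmaps f, sum_product]
    refine sum_congr rfl fun k _ => sum_congr rfl fun g _ => ?_
    rw [hfib_eq]
  -- hypotheses of the aggregated statement
  have hWnn : ∀ k g, 0 ≤ W k g := fun k g => sum_nonneg fun c _ => hw c
  have hW₁nn : ∀ k g, 0 ≤ W₁ k g := fun k g => sum_nonneg fun c _ => hw₁ c
  have hunif' : ∀ k g, W₁ k g ≤ (1 + ε₂) / Fintype.card G * ∑ g', W₁ k g' := by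
    intro k g
    have hk : ∑ g', W₁ k g' = ∑ c ∈ S.filter (fun c => acc c ∧ klab c = k), w₁ c := by
      have hm : ∀ c ∈ S.filter (fun c => acc c ∧ klab c = k), glab c ∈ (univ : Finset G) := fun c _ => mem_univ _
      rw [← sum_fiberwise_of_maps_to hm]
      refine sum_congr rfl fun g' _ => ?_
      simp only [hW₁d, hfib, filter_filter]
      refine sum_congr ?_ fun _ _ => rfl
      ext c; simp only [mem_filter, and_assoc]
    rw [hk]
    exact hunif k g
  have hmass' : ∑ k ∈ K, ∑ g, W k g ≤ 1 := by
    calc ∑ k ∈ K, ∑ g, W k g = ∑ c ∈ Sa, w c := (hagg w).symm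
      _ ≤ ∑ c ∈ S, w c := sum_le_sum_of_subset_of_nonneg (filter_subset _ _) fun c _ _ => hw c
      _ ≤ 1 := hmass
  have hdiff' : ∑ k ∈ K, ∑ g, |W k g - W₁ k g| ≤ ε₃ := by
    calc ∑ k ∈ K, ∑ g, |W k g - W₁ k g| ≤ ∑ k ∈ K, ∑ g, ∑ c ∈ fib k g, |w c - w₁ c| := by
          refine sum_le_sum fun k _ => sum_le_sum fun g _ => ?_
          simp only [hWd, hW₁d, ← sum_sub_distrib]
          exact abs_sum_le_sum_abs _ _
      _ = ∑ c ∈ Sa, |w c - w₁ c| := (hagg _).symm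
      _ ≤ ∑ c ∈ S, |w c - w₁ c| := sum_le_sum_of_subset_of_nonneg (filter_subset _ _) fun c _ _ => abs_nonneg _
      _ ≤ ε₃ := hdiff
  have hmain := sum_pair_filter_le K W W₁ cf H hWnn hW₁nn hunif' hmass' hdiff' hcf hH hε₂
  -- the event sum, aggregated
  refine le_trans (le_of_eq ?_) hmain
  -- restrict to accurate outcomes
  have hrestr : ∑ c ∈ S, ∑ c' ∈ S, (if acc c ∧ acc c' ∧ (cf (klab c) (klab c')).1 • glab c +
        (cf (klab c) (klab c')).2 • glab c' ∈ H then w c * w c' else 0) =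
      ∑ c ∈ Sa, ∑ c' ∈ Sa, (if (cf (klab c) (klab c')).1 • glab c + (cf (klab c) (klab c')).2 • glab c' ∈ H
        then w c * w c' else 0) := by
    rw [hSa, sum_filter]
    refine sum_congr rfl fun c _ => ?_
    by_cases hc : acc c
    · rw [if_pos hc, sum_filter]
      refine sum_congr rfl fun c' _ => ?_
      by_cases hc' : acc c'
      · simp [hc, hc']
      · simp [hc']
    · rw [if_neg hc]
      exact sum_eq_zero fun c' _ => by simp [hc]
  rw [hrestr, hagg]
  refine sum_congr rfl fun k _ => ?_
  -- inner aggregation in `c'`, then constancy of the labels on the fibres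
  have hstep : ∀ g, ∑ c ∈ fib k g, ∑ c' ∈ Sa, (if (cf (klab c) (klab c')).1 • glab c +
        (cf (klab c) (klab c')).2 • glab c' ∈ H then w c * w c' else 0) =
      ∑ k' ∈ K, ∑ g', (if (cf k k').1 • g + (cf k k').2 • g' ∈ H then W k g * W k' g' else 0) := by
    intro g
    calc ∑ c ∈ fib k g, ∑ c' ∈ Sa, (if (cf (klab c) (klab c')).1 • glab c + (cf (klab c) (klab c')).2 • glab c' ∈ H
            then w c * w c' else 0)
        = ∑ c ∈ fib k g, ∑ k' ∈ K, ∑ g', ∑ c' ∈ fib k' g', (if (cf (klab c) (klab c')).1 • glab c +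
            (cf (klab c) (klab c')).2 • glab c' ∈ H then w c * w c' else 0) :=
          sum_congr rfl fun c _ => hagg _
      _ = ∑ c ∈ fib k g, ∑ k' ∈ K, ∑ g', ∑ c' ∈ fib k' g',
            (if (cf k k').1 • g + (cf k k').2 • g' ∈ H then w c * w c' else 0) := by
          refine sum_congr rfl fun c hc => sum_congr rfl fun k' _ => sum_congr rfl fun g' _ =>
            sum_congr rfl fun c' hc' => ?_
          simp only [hfib, mem_filter] at hc hc'
          rw [hc.2.2.1, hc.2.2.2, hc'.2.2.1, hc'.2.2.2]
      _ = ∑ k' ∈ K, ∑ g', ∑ c ∈ fib k g, ∑ c' ∈ fib k' g',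
            (if (cf k k').1 • g + (cf k k').2 • g' ∈ H then w c * w c' else 0) := by
          rw [sum_comm]
          refine sum_congr rfl fun k' _ => ?_
          rw [sum_comm]
      _ = ∑ k' ∈ K, ∑ g', (if (cf k k').1 • g + (cf k k').2 • g' ∈ H then W k g * W k' g' else 0) := by
          refine sum_congr rfl fun k' _ => sum_congr rfl fun g' _ => ?_
          split_ifs with hmem
          · rw [hWd, sum_mul_sum]
          · exact sum_eq_zero fun c _ => sum_eq_zero fun c' _ => rfl
  calc ∑ g, ∑ c ∈ fib k g, ∑ c' ∈ Sa, (if (cf (klab c) (klab c')).1 • glab c + (cf (klab c) (klab c')).2 • glab c' ∈ H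
          then w c * w c' else 0)
      = ∑ g, ∑ k' ∈ K, ∑ g', (if (cf k k').1 • g + (cf k k').2 • g' ∈ H then W k g * W k' g' else 0) :=
        sum_congr rfl fun g _ => hstep g
    _ = ∑ k' ∈ K, ∑ g, ∑ g', (if (cf k k').1 • g + (cf k k').2 • g' ∈ H then W k g * W k' g' else 0) := sum_comm
    _ = ∑ k' ∈ K, ∑ p ∈ (univ : Finset (G × G)).filter (fun p => (cf k k').1 • p.1 + (cf k k').2 • p.2 ∈ H),
          W k p.1 * W k' p.2 := by
        refine sum_congr rfl fun k' _ => ?_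
        rw [sum_filter, Fintype.sum_prod_type]

/-- **Near-uniform pairs rarely land in a small set**, uncurried summary form of `sum_pair_event_le` (universe `0`).
[cite: Hallgren2005, §4] -/
theorem pair_event_mass_le : ∀ (G : Type) [AddCommGroup G] [Fintype G] [DecidableEq G] (α : Type) (S : Finset α)
    (acc : α → Prop) [DecidablePred acc] (klab : α → ℤ) (glab : α → G) (w w₁ : α → ℝ) (cf : ℤ → ℤ → ℤ × ℤ) (ε₂ ε₃ : ℝ)
    (H : Finset G), (∀ c, 0 ≤ w c) → (∀ c, 0 ≤ w₁ c) → ∑ c ∈ S, w c ≤ 1 → ∑ c ∈ S, |w c - w₁ c| ≤ ε₃ →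
    (∀ (kk : ℤ) (g : G), ∑ c ∈ S.filter (fun c => acc c ∧ klab c = kk ∧ glab c = g), w₁ c ≤
      (1 + ε₂) / Fintype.card G * ∑ c ∈ S.filter (fun c => acc c ∧ klab c = kk), w₁ c) →
    (∀ k k', Int.gcd (cf k k').1 (cf k k').2 = 1) → 2 * H.card ≤ Fintype.card G → 0 ≤ ε₂ →
    ∑ c ∈ S, ∑ c' ∈ S, (if acc c ∧ acc c' ∧ (cf (klab c) (klab c')).1 • glab c + (cf (klab c) (klab c')).2 • glab c' ∈ H
      then w c * w c' else 0) ≤ (1 + ε₂) ^ 2 / 2 * (1 + ε₃) ^ 2 :=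
  fun _ _ _ _ _ S acc _ klab glab w w₁ cf _ _ H hw hw₁ hmass hdiff hunif hcf hH hε₂ =>
    sum_pair_event_le S acc klab glab w w₁ cf H hw hw₁ hmass hdiff hunif hcf hH hε₂

/-- The arithmetic of the final form: `(1+ε₂)²/2 · (1+ε₃)² ≤ (1+ε₂)²/2 + 3 ε₃` when `(1+ε₂)² ≤ 2` and `0 ≤ ε₃ ≤ 1`. [folklore] -/
theorem half_sq_mul_sq_le {ε₂ ε₃ : ℝ} (h2 : (1 + ε₂) ^ 2 ≤ 2) (h3 : 0 ≤ ε₃) (h3' : ε₃ ≤ 1) :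
    (1 + ε₂) ^ 2 / 2 * (1 + ε₃) ^ 2 ≤ (1 + ε₂) ^ 2 / 2 + 3 * ε₃ := by
  nlinarith [sq_nonneg (1 + ε₂), mul_nonneg h3 h3, mul_nonneg h3 (sub_nonneg.2 h3')]

end CubicClassPost

end Literature.Computability.Cryptography

end
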